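import Mathlib
import Summits.RiemannHypothesis.RiemannHypothesis.Theorems.DensityLadderSeparatedTowerReal
import Summits.RiemannHypothesis.RiemannHypothesis.Theorems.DensityLadderSeparatedTowerPointwise
import Summits.RiemannHypothesis.RiemannHypothesis.Theorems.DensityLadderSeparatedTowerTransform
import Summits.RiemannHypothesis.RiemannHypothesis.Theorems.DensityLadderSeparatedTowerTransformDecay
import Summits.RiemannHypothesis.RiemannHypothesis.Theorems.DensityLadderSeparatedTowerGaussian
import Summits.RiemannHypothesis.RiemannHypothesis.Theorems.DensityLadderSeparatedTowerOffDiagonal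
import Summits.RiemannHypothesis.RiemannHypothesis.Theorems.DensityLadderSeparatedTowerWindows
import Summits.RiemannHypothesis.RiemannHypothesis.Theorems.DensityLadderSeparatedTowerSchur
import Summits.RiemannHypothesis.RiemannHypothesis.Theorems.DensityLadderSeparatedTowerCount
import Summits.RiemannHypothesis.RiemannHypothesis.Theorems.DensityLadderSeparatedTowerTameFinite
import Summits.RiemannHypothesis.RiemannHypothesis.Theorems.DensityLadderSeparatedTowerGaussianReal
import Summits.RiemannHypothesis.RiemannHypothesis.Theorems.DensityLadderSeparatedTowerMVLower
import Summits.RiemannHypothesis.RiemannHypothesis.Theorems.DensityLadderSeparatedTowerWindowSums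
import Summits.RiemannHypothesis.RiemannHypothesis.Theorems.DensityLadderSeparatedTowerUpperBound
import HarnessLib

/-!
# `DensityLadder.SeparatedTowerDensityLine` (item stmt-RiemannHypothesis-24918) — stub S1
# `stub_separatedMeanValueCount` of the registered skeleton `Birth.lean` (LINE L57, rh-idea-10 g1)

The S1 signature VERBATIM: for a configuration satisfying the prime-side, tame and (count-free)
tower clauses of K1, every line `σ₀ ∈ (1/2, β)` has
`#{σ₀ ≤ Re ρ, |Im ρ| ≤ T} ≤ C T^{2(1−σ₀)} log² T` for `T ≥ T₀`.
Proof = the mean-value comparison of the line's memo at the fixed bump `φ` (`ContDiffBump`, radii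
`1/4 < 1/2`), height `A = 4(T+1)`, `η = 1/A`, `U = log A`, Gaussian width `L = 2/g`, tower part
truncated at `|γ| ≤ T⁴`: LOWER half `κ A^{2σ₀} N(σ₀,T) ≤ Re ΣΣ b b̄ Ĝ = ∫ |Z_F|² G` (visibility
`re_windowTransform_ge`, `mv_lower_bound`, finiteness from `g`-separation) and UPPER half
`∫ |Z_F|² G ≤ C_up A² log² A` (`DensityLadderSeparatedTowerUpperBound.upper_bound`), then algebra.
With S2 (`DensityLadderSeparatedTowerExponent`) this closes K1 via `SeparatedTowerDensityLine_of`.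
Cell rh-split, seat rh-split-prover-l57 g0 (LOWER also landed independently by prover-l57b as
`DensityLadderSeparatedTowerLower`).  RH-free, ζ-free; FRONTIER bookkeeping, DH-capped; nothing here
bears on the truth of RH.
-/

set_option linter.dupNamespace false
set_option maxHeartbeats 800000

noncomputable section

open Complex Filter Set MeasureTheory Topology
open scoped Real ComplexConjugate

namespace Summit.RiemannHypothesis.RiemannHypothesis.Theorems.DensityLadderSeparatedTowerMeanValue

open Summit.RiemannHypothesis.RiemannHypothesis.Theorems.DensityLadderSeparatedTowerReal
open Summit.RiemannHypothesis.RiemannHypothesis.Theorems.DensityLadderSeparatedTowerPointwise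
open Summit.RiemannHypothesis.RiemannHypothesis.Theorems.DensityLadderSeparatedTowerTransform
open Summit.RiemannHypothesis.RiemannHypothesis.Theorems.DensityLadderSeparatedTowerTransformDecay
open Summit.RiemannHypothesis.RiemannHypothesis.Theorems.DensityLadderSeparatedTowerGaussian
open Summit.RiemannHypothesis.RiemannHypothesis.Theorems.DensityLadderSeparatedTowerOffDiagonal
open Summit.RiemannHypothesis.RiemannHypothesis.Theorems.DensityLadderSeparatedTowerWindows
open Summit.RiemannHypothesis.RiemannHypothesis.Theorems.DensityLadderSeparatedTowerSchur
open Summit.RiemannHypothesis.RiemannHypothesis.Theorems.DensityLadderSeparatedTowerWindowSums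
open Summit.RiemannHypothesis.RiemannHypothesis.Theorems.DensityLadderSeparatedTowerCount
open Summit.RiemannHypothesis.RiemannHypothesis.Theorems.DensityLadderSeparatedTowerTameFinite
open Summit.RiemannHypothesis.RiemannHypothesis.Theorems.DensityLadderSeparatedTowerGaussianReal
open Summit.RiemannHypothesis.RiemannHypothesis.Theorems.DensityLadderSeparatedTowerMVLower
open Summit.RiemannHypothesis.RiemannHypothesis.Theorems.DensityLadderSeparatedTowerUpperBound

/-- **Stub S1 `stub_separatedMeanValueCount`** (registered signature, verbatim): the separated
mean-value count on every line `σ₀ ∈ (1/2, β)`. [folklore] -/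
theorem separatedTower_meanValueCount :
    ∀ (ι : Type) (m : ι → ℝ) (ρ : ι → ℂ) (w : ℕ → ℝ) (β g : ℝ), 1 / 2 < β → β < 1 → 0 < g →
    ((∃ B : ℝ, ∀ n : ℕ, 0 ≤ w n ∧ w n ≤ B * Real.log ((n : ℝ) + 2)) ∧
      (∀ φ : ℝ → ℝ, ContDiff ℝ 2 φ → (∀ v, 0 ≤ φ v) → (∀ v, 1 ≤ |v| → φ v = 0) →
        ∃ Cφ : ℝ, ∀ η x : ℝ, 0 < η → η ≤ 1 / 2 → 3 ≤ x →
          Summable (fun i : ι ↦ m i * ‖(x : ℂ) ^ (ρ i) *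
            ∫ v in (-1 : ℝ)..1, (φ v : ℂ) * ((1 : ℂ) + (η : ℂ) * (v : ℂ)) ^ (ρ i - 1)‖) ∧
          |(∑' n : ℕ, w n * φ (((n : ℝ) / x - 1) / η)) - η * x * (∫ v in (-1 : ℝ)..1, φ v)
              + η * (∑' i : ι, (m i : ℂ) * ((x : ℂ) ^ (ρ i) *
                ∫ v in (-1 : ℝ)..1, (φ v : ℂ) * ((1 : ℂ) + (η : ℂ) * (v : ℂ)) ^ (ρ i - 1))).re|
            ≤ Cφ * Real.log x)) →
    ((∃ C : ℝ, ∀ T : ℝ, {i : ι | (ρ i).re ≤ 1 / 2 ∧ |(ρ i).im - T| ≤ 1}.Finite ∧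
        (∑ᶠ i ∈ {i : ι | (ρ i).re ≤ 1 / 2 ∧ |(ρ i).im - T| ≤ 1}, m i) ≤ C * Real.log (|T| + 2)) ∧
      (∀ i : ι, 0 ≤ m i) ∧ (∀ i : ι, (ρ i).re ≤ 1 / 2 → 0 ≤ (ρ i).re) ∧
      (∃ σ : ι → ι, ∀ i : ι, σ (σ i) = i ∧ ρ (σ i) = (starRingEnd ℂ) (ρ i) ∧ m (σ i) = m i)) →
    ((∃ B : ℝ, ∀ i : ι, 1 / 2 < (ρ i).re → (ρ i).re < β ∧ 1 ≤ m i ∧ m i ≤ B) ∧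
      (∀ β' : ℝ, β' < β → {i : ι | 1 / 2 < (ρ i).re ∧ (ρ i).re ≤ β'}.Finite) ∧
      (∀ i j : ι, 1 / 2 < (ρ i).re → 1 / 2 < (ρ j).re → i ≠ j → g ≤ |(ρ i).im - (ρ j).im|)) →
    (∀ σ₀ : ℝ, 1 / 2 < σ₀ → σ₀ < β → ∃ C T₀ : ℝ, ∀ T : ℝ, T₀ ≤ T →
        ({i : ι | σ₀ ≤ (ρ i).re ∧ |(ρ i).im| ≤ T}.ncard : ℝ) ≤ C * T ^ (2 * (1 - σ₀)) * Real.log T ^ 2) := by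
  intro ι m ρ w β g hβ hβ1 hg hP hT hTow σ₀ hσ₀ hσ₀β
  obtain ⟨⟨B, hw⟩, hEF⟩ := hP
  obtain ⟨⟨Ct, htame⟩, hm0, hre0, ⟨σinv, hσinv⟩⟩ := hT
  obtain ⟨⟨B', htow⟩, hdisc, hsep⟩ := hTow
  /- Step 0: the bump `φ` and its constants. -/
  set bump : ContDiffBump (0 : ℝ) := ⟨1 / 4, 1 / 2, by norm_num, by norm_num⟩ with hbump
  set φ : ℝ → ℝ := fun v ↦ (bump : ContDiffBump (0 : ℝ)) v with hφdef
  have hφC2 : ContDiff ℝ 2 φ := bump.contDiff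
  have hφ0 : ∀ v, 0 ≤ φ v := fun v ↦ bump.nonneg
  have hφ1 : ∀ v, φ v ≤ 1 := fun v ↦ bump.le_one
  have hφs : ∀ v, 1 ≤ |v| → φ v = 0 := fun v hv ↦ by
    refine bump.zero_of_le_dist ?_
    show (bump : ContDiffBump (0 : ℝ)).rOut ≤ dist v 0
    rw [Real.dist_eq, sub_zero]
    show (1 / 2 : ℝ) ≤ |v|
    linarith
  have hMφ : ∀ v, |φ v| ≤ 1 := fun v ↦ by rw [abs_of_nonneg (hφ0 v)]; exact hφ1 v
  obtain ⟨M₂, hM₂⟩ : ∃ M₂ : ℝ, ∀ v, |deriv (deriv φ) v| ≤ M₂ := by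
    have hc : Continuous (deriv (deriv φ)) := by
      have h1 : ContDiff ℝ 1 (deriv φ) := hφC2.deriv'
      exact h1.continuous_deriv le_rfl
    have hs : HasCompactSupport (deriv (deriv φ)) := bump.hasCompactSupport.deriv.deriv
    obtain ⟨C, hC⟩ := hc.bounded_above_of_compact_support hs
    exact ⟨C, fun v ↦ (Real.norm_eq_abs _).symm.le.trans (hC v)⟩
  obtain ⟨Cφ, hCφ⟩ := hEF φ hφC2 hφ0 hφs
  /- Step 1: the pointwise bound for the full zero sum, `x ≥ 3`, `0 < η ≤ 1/2`. -/
  have hS : ∀ η x : ℝ, 0 < η → η ≤ 1 / 2 → 3 ≤ x →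
      ‖∑' i : ι, (m i : ℂ) * ((x : ℂ) ^ (ρ i) *
        ∫ v in (-1 : ℝ)..1, (φ v : ℂ) * ((1 : ℂ) + (η : ℂ) * (v : ℂ)) ^ (ρ i - 1))‖ ≤
        (Cφ + 2 * 1 + 6 * |B| * 1) * (x * Real.log x + Real.log x / η) := by
    intro η x hη hη1 hx
    rw [norm_zeroSum_eq_abs_re m ρ σinv hσinv φ hη hη1 (by linarith)]
    exact pointwise_zeroSum_re_bound m ρ w hw φ hMφ hφs (fun η x hη hη1 hx ↦ (hCφ η x hη hη1 hx).2)
      hη hη1 hx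
  /- Step 2: the finite truncations (tower: g-separation; tame: finite windows). -/
  have hFfin : ∀ R : ℝ, 0 ≤ R → {i : ι | 1 / 2 < (ρ i).re ∧ |(ρ i).im| ≤ R}.Finite ∧
      (({i : ι | 1 / 2 < (ρ i).re ∧ |(ρ i).im| ≤ R}.ncard : ℝ) ≤ 2 * R / g + 1) := fun R hR ↦
    finite_and_ncard_le_of_separated (fun i ↦ (ρ i).im) (fun i ↦ 1 / 2 < (ρ i).re) hg
      (fun i j hi hj hij ↦ hsep i j hi hj hij) hR
  have hAfin : ∀ R : ℝ, {i : ι | (ρ i).re ≤ 1 / 2 ∧ |(ρ i).im| ≤ R}.Finite := fun R ↦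
    finite_of_windows_finite (fun i ↦ (ρ i).im) (fun i ↦ (ρ i).re ≤ 1 / 2) (fun t ↦ (htame t).1) R
  /- Step 3: the two halves of the mean-value comparison, at height `T ≥ 3` with
     `A = 4(T+1)`, `η = 1/A`, `U = log A`, `L = 2/g`, tower truncated at `|γ| ≤ T^4`. -/
  set L : ℝ := 2 / g with hL
  have hL0 : 0 < L := by positivity
  set Iφ : ℝ := ∫ v in (-1 : ℝ)..1, φ v with hIφ
  -- LOWER half (memo (h)): visibility (c3) + Montgomery–Vaughan lower bound (MVLower) + d-finite.
  have lower : ∀ T : ℝ, 3 ≤ T →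
      (1 / 2) * (Real.sqrt (2 * π) * L) * ((7 / 16 * Iφ) ^ 2 * (4 * (T + 1)) ^ (2 * σ₀)) *
          ({i : ι | σ₀ ≤ (ρ i).re ∧ |(ρ i).im| ≤ T}.ncard : ℝ) ≤
        ∫ u : ℝ, ‖∑ i ∈ (hFfin (T ^ 4) (by positivity)).1.toFinset,
            (m i : ℂ) * (∫ v in (-1 : ℝ)..1, (φ v : ℂ) *
              ((1 : ℂ) + ((1 / (4 * (T + 1)) : ℝ) : ℂ) * (v : ℂ)) ^ (ρ i - 1)) * cexp (ρ i * u)‖ ^ 2 *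
          Real.exp (-(u - Real.log (4 * (T + 1))) ^ 2 / (2 * L ^ 2)) := by
    intro T hT
    classical
    set A : ℝ := 4 * (T + 1) with hA
    have hA0 : 0 < A := by positivity
    have hA1 : 1 ≤ A := by rw [hA]; linarith
    set η : ℝ := 1 / A with hη
    have hη0 : 0 < η := by positivity
    have hη1 : η ≤ 1 / 2 := by
      rw [hη, div_le_div_iff₀ hA0 (by norm_num)]; rw [hA]; linarith
    set U : ℝ := Real.log A with hU
    have hU0 : 0 ≤ U := Real.log_nonneg hA1
    set F : Finset ι := (hFfin (T ^ 4) (by positivity)).1.toFinset with hF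
    have hmemF : ∀ i, i ∈ F ↔ 1 / 2 < (ρ i).re ∧ |(ρ i).im| ≤ T ^ 4 := fun i ↦ by
      rw [hF, Set.Finite.mem_toFinset]; rfl
    set c : ι → ℂ := fun i ↦ ∫ v in (-1 : ℝ)..1, (φ v : ℂ) *
      ((1 : ℂ) + ((η : ℝ) : ℂ) * (v : ℂ)) ^ (ρ i - 1) with hc
    set b : ι → ℂ := fun i ↦ (m i : ℂ) * c i with hb
    -- (i) the mean square as the real part of the double sum
    have hJ := integral_normSq_sum_mul_gaussian F b ρ hL0 U
    have hJre : ∫ u : ℝ, ‖∑ i ∈ F, b i * cexp (ρ i * u)‖ ^ 2 * Real.exp (-(u - U) ^ 2 / (2 * L ^ 2)) =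
        (∑ i ∈ F, ∑ j ∈ F, b i * conj (b j) * (((Real.sqrt (2 * π) * L : ℝ) : ℂ) *
          cexp ((ρ i + conj (ρ j)) * U + (ρ i + conj (ρ j)) ^ 2 * L ^ 2 / 2))).re := by
      have hprod : (∫ u : ℝ, (((‖∑ i ∈ F, b i * cexp (ρ i * u)‖ ^ 2 : ℝ) : ℂ)) *
          (Real.exp (-(u - U) ^ 2 / (2 * L ^ 2)) : ℂ)) =
          ((∫ u : ℝ, ‖∑ i ∈ F, b i * cexp (ρ i * u)‖ ^ 2 * Real.exp (-(u - U) ^ 2 / (2 * L ^ 2)) : ℝ) : ℂ) := by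
        rw [← integral_complex_ofReal]
        refine integral_congr_ae (Eventually.of_forall fun u ↦ ?_)
        push_cast; ring
      rw [← hJ, hprod, Complex.ofReal_re]
    -- (ii) the Montgomery–Vaughan lower bound on `F`
    have hsepF : ∀ i ∈ F, ∀ j ∈ F, i ≠ j → g ≤ |(ρ i).im - (ρ j).im| := fun i hi j hj hij ↦
      hsep i j ((hmemF i).1 hi).1 ((hmemF j).1 hj).1 hij
    have hMV := mv_lower_bound F (fun i ↦ (ρ i).re) (fun i ↦ (ρ i).im) b hg hsepF U
    have hzform : ∀ i j, (((((ρ i).re + (ρ j).re : ℝ)) : ℂ) + (((ρ i).im - (ρ j).im : ℝ) : ℂ) * I) =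
        ρ i + conj (ρ j) := fun i j ↦ by
      apply Complex.ext <;> (simp; try ring)
    have hDS : (∑ i ∈ F, ∑ j ∈ F, b i * conj (b j) * (((Real.sqrt (2 * π) * (2 / g) : ℝ) : ℂ) *
        cexp ((((((ρ i).re + (ρ j).re : ℝ)) : ℂ) + (((ρ i).im - (ρ j).im : ℝ) : ℂ) * I) * U +
          (((((ρ i).re + (ρ j).re : ℝ)) : ℂ) + (((ρ i).im - (ρ j).im : ℝ) : ℂ) * I) ^ 2 * (2 / g : ℝ) ^ 2 / 2))).re =
        (∑ i ∈ F, ∑ j ∈ F, b i * conj (b j) * (((Real.sqrt (2 * π) * L : ℝ) : ℂ) *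
          cexp ((ρ i + conj (ρ j)) * U + (ρ i + conj (ρ j)) ^ 2 * L ^ 2 / 2))).re := by
      congr 1
      refine Finset.sum_congr rfl fun i _ ↦ Finset.sum_congr rfl fun j _ ↦ ?_
      rw [hzform i j, hL]
    rw [hDS] at hMV
    -- (iii) visibility: the target set sits inside `F` with large diagonal terms
    have hT4 : T ≤ T ^ 4 := le_self_pow₀ (by linarith) (by norm_num)
    have hSfin : {i : ι | σ₀ ≤ (ρ i).re ∧ |(ρ i).im| ≤ T}.Finite :=
      (hFfin (T ^ 4) (by positivity)).1.subset fun i hi ↦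
        ⟨lt_of_lt_of_le hσ₀ hi.1, hi.2.trans hT4⟩
    set S : Finset ι := hSfin.toFinset with hSdef
    have hSF : S ⊆ F := by
      intro i hi
      rw [hSdef, Set.Finite.mem_toFinset] at hi
      rw [hmemF]
      exact ⟨lt_of_lt_of_le hσ₀ hi.1, hi.2.trans hT4⟩
    have hncard : ({i : ι | σ₀ ≤ (ρ i).re ∧ |(ρ i).im| ≤ T}.ncard : ℝ) = (S.card : ℝ) := by
      rw [hSdef, Set.ncard_eq_toFinset_card _ hSfin]
    have hterm : ∀ i ∈ S, (7 / 16 * Iφ) ^ 2 * A ^ (2 * σ₀) ≤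
        ‖b i‖ ^ 2 * Real.exp (2 * (ρ i).re * U + 2 * (ρ i).re ^ 2 * (2 / g) ^ 2) := by
      intro i hi
      rw [hSdef, Set.Finite.mem_toFinset] at hi
      obtain ⟨hσi, hγi⟩ := hi
      have hre1 : 1 / 2 < (ρ i).re := lt_of_lt_of_le hσ₀ hσi
      obtain ⟨hβi, hmi, -⟩ := htow i hre1
      have hvis : η * (1 + |(ρ i).im|) ≤ 1 / 4 := by
        rw [hη, hA, div_mul_eq_mul_div, one_mul, div_le_div_iff₀ hA0 (by norm_num)]
        rw [hA]; nlinarith [abs_nonneg (ρ i).im]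
      have hcre := re_windowTransform_ge φ bump.continuous hφ0 hη0 hη1 (by linarith) (by linarith) hvis
      have hcnorm : 7 / 16 * Iφ ≤ ‖c i‖ := le_trans hcre (Complex.re_le_norm _)
      have hbnorm : 7 / 16 * Iφ ≤ ‖b i‖ := by
        rw [hb]; simp only
        rw [norm_mul, Complex.norm_real, Real.norm_of_nonneg (by linarith)]
        calc 7 / 16 * Iφ ≤ 1 * ‖c i‖ := by rw [one_mul]; exact hcnorm
          _ ≤ m i * ‖c i‖ := mul_le_mul_of_nonneg_right hmi (norm_nonneg _)
      have hI0 : 0 ≤ 7 / 16 * Iφ := by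
        have : 0 ≤ Iφ := by
          rw [hIφ]; exact intervalIntegral.integral_nonneg (by norm_num) fun v _ ↦ hφ0 v
        positivity
      have hsq : (7 / 16 * Iφ) ^ 2 ≤ ‖b i‖ ^ 2 := pow_le_pow_left₀ hI0 hbnorm 2
      have hexp : A ^ (2 * σ₀) ≤ Real.exp (2 * (ρ i).re * U + 2 * (ρ i).re ^ 2 * (2 / g) ^ 2) := by
        rw [Real.rpow_def_of_pos hA0, Real.exp_le_exp]
        have h1 : Real.log A * (2 * σ₀) ≤ 2 * (ρ i).re * U := by rw [hU]; nlinarith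
        nlinarith [sq_nonneg ((ρ i).re * (2 / g))]
      exact mul_le_mul hsq hexp (Real.rpow_nonneg hA0.le _) (sq_nonneg _)
    have hsumS : (S.card : ℝ) * ((7 / 16 * Iφ) ^ 2 * A ^ (2 * σ₀)) ≤
        ∑ i ∈ F, ‖b i‖ ^ 2 * Real.exp (2 * (ρ i).re * U + 2 * (ρ i).re ^ 2 * (2 / g) ^ 2) := by
      calc (S.card : ℝ) * ((7 / 16 * Iφ) ^ 2 * A ^ (2 * σ₀))
          = ∑ i ∈ S, (7 / 16 * Iφ) ^ 2 * A ^ (2 * σ₀) := by rw [Finset.sum_const, nsmul_eq_mul]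
        _ ≤ ∑ i ∈ S, ‖b i‖ ^ 2 * Real.exp (2 * (ρ i).re * U + 2 * (ρ i).re ^ 2 * (2 / g) ^ 2) :=
            Finset.sum_le_sum hterm
        _ ≤ ∑ i ∈ F, ‖b i‖ ^ 2 * Real.exp (2 * (ρ i).re * U + 2 * (ρ i).re ^ 2 * (2 / g) ^ 2) :=
            Finset.sum_le_sum_of_subset_of_nonneg hSF fun i _ _ ↦ by positivity
    -- assemble
    rw [hncard]
    have hfinal : 1 / 2 * (Real.sqrt (2 * π) * L) * ((7 / 16 * Iφ) ^ 2 * A ^ (2 * σ₀)) * (S.card : ℝ) ≤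
        (∑ i ∈ F, ∑ j ∈ F, b i * conj (b j) * (((Real.sqrt (2 * π) * L : ℝ) : ℂ) *
          cexp ((ρ i + conj (ρ j)) * U + (ρ i + conj (ρ j)) ^ 2 * L ^ 2 / 2))).re := by
      have h0 : 0 ≤ 1 / 2 * (Real.sqrt (2 * π) * L) := by positivity
      have := mul_le_mul_of_nonneg_left hsumS h0
      rw [hL] at hMV ⊢
      linarith
    rw [← hJre] at hfinal
    exact hfinal
  -- UPPER half (memo (f)+(g)): `DensityLadderSeparatedTowerUpperBound.upper_bound`.
  set Ca : ℝ := Cφ + 2 * 1 + 6 * |B| * 1 with hCa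
  set Ct' : ℝ := max Ct 0 with hCt'
  have hCt'0 : 0 ≤ Ct' := le_max_right _ _
  have htame' : ∀ t : ℝ, (∑ᶠ i ∈ {i : ι | (ρ i).re ≤ 1 / 2 ∧ |(ρ i).im - t| ≤ 1}, m i) ≤
      Ct' * Real.log (|t| + 2) := fun t ↦ (htame t).2.trans
    (mul_le_mul_of_nonneg_right (le_max_left _ _) (Real.log_nonneg (by linarith [abs_nonneg t])))
  set B'' : ℝ := max B' 0 with hB''
  have hB''0 : 0 ≤ B'' := le_max_right _ _
  set M₂' : ℝ := max M₂ 0 with hM₂'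
  have hM₂'0 : 0 ≤ M₂' := le_max_right _ _
  have hM₂'' : ∀ v, |deriv (deriv φ) v| ≤ M₂' := fun v ↦ (hM₂ v).trans (le_max_left _ _)
  -- real parts of all zeros lie in `[0, 1]`
  have hre01 : ∀ i, 0 ≤ (ρ i).re ∧ (ρ i).re ≤ 1 := by
    intro i
    rcases le_or_gt ((ρ i).re) (1 / 2) with h | h
    · exact ⟨hre0 i h, by linarith⟩
    · exact ⟨by linarith, (htow i h).1.le.trans hβ1.le⟩
  have upper : ∃ Cup : ℝ, 0 < Cup ∧ ∀ T : ℝ, 3 ≤ T →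
      ∫ u : ℝ, ‖∑ i ∈ (hFfin (T ^ 4) (by positivity)).1.toFinset,
            (m i : ℂ) * (∫ v in (-1 : ℝ)..1, (φ v : ℂ) *
              ((1 : ℂ) + ((1 / (4 * (T + 1)) : ℝ) : ℂ) * (v : ℂ)) ^ (ρ i - 1)) * cexp (ρ i * u)‖ ^ 2 *
          Real.exp (-(u - Real.log (4 * (T + 1))) ^ 2 / (2 * L ^ 2)) ≤
        Cup * (4 * (T + 1)) ^ 2 * Real.log (4 * (T + 1)) ^ 2 := by
    obtain ⟨Cup, hCup0, hup⟩ := upper_bound m ρ hm0 hre01 hg hB''0 hCt'0 hM₂'0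
      (fun i hi ↦ (htow i hi).2.2.trans (le_max_left _ _)) hsep (fun t ↦ ⟨(htame t).1, htame' t⟩)
      φ hφC2 hφs hMφ hM₂'' hS (fun η x hη hη1 hx ↦ (hCφ η x hη hη1 hx).1)
    exact ⟨Cup, hCup0, fun T hT ↦ hup T hT _ (fun i ↦ by
      simp only [Set.Finite.mem_toFinset, Set.mem_setOf_eq])⟩
  /- Step 4: conclusion. -/
  obtain ⟨Cup, hCup0, hup⟩ := upper
  have hIφ0 : 0 < Iφ := by
    have hsupp : Function.support φ ⊆ Set.Ioc (-1 : ℝ) 1 := by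
      intro v hv
      rw [Function.mem_support] at hv
      by_contra h
      rw [Set.mem_Ioc, not_and_or, not_lt, not_le] at h
      apply hv
      apply hφs
      rcases h with h | h
      · rw [abs_of_nonpos (by linarith)]; linarith
      · rw [abs_of_pos (by linarith)]; linarith
    rw [hIφ, intervalIntegral.integral_eq_integral_of_support_subset hsupp]
    exact bump.integral_pos
  set κ : ℝ := (1 / 2) * (Real.sqrt (2 * π) * L) * (7 / 16 * Iφ) ^ 2 with hκ
  have hκ0 : 0 < κ := by positivity
  refine ⟨Cup / κ * 8 ^ 2 * 3 ^ 2, 8, fun T hT ↦ ?_⟩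
  have hT3 : (3 : ℝ) ≤ T := by linarith
  have h1 := lower T hT3
  have h2 := hup T hT3
  set A : ℝ := 4 * (T + 1) with hA
  have hA0 : 0 < A := by positivity
  have hAT : A ≤ 8 * T := by rw [hA]; linarith
  set N : ℝ := ({i : ι | σ₀ ≤ (ρ i).re ∧ |(ρ i).im| ≤ T}.ncard : ℝ) with hN
  have hN0 : 0 ≤ N := by positivity
  -- `κ A^{2σ₀} N ≤ Cup A² log²A`
  have h3 : κ * A ^ (2 * σ₀) * N ≤ Cup * A ^ 2 * Real.log A ^ 2 := by
    have := h1.trans h2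
    have e : κ * A ^ (2 * σ₀) * N =
        1 / 2 * (Real.sqrt (2 * π) * L) * ((7 / 16 * Iφ) ^ 2 * A ^ (2 * σ₀)) * N := by rw [hκ]; ring
    rw [e]; exact this
  -- `log A ≤ 3 log T` for `T ≥ 8`, and `A^{2-2σ₀} ≤ 8² T^{2-2σ₀}`
  have hlogT : 0 < Real.log T := Real.log_pos (by linarith)
  have hlogA : Real.log A ≤ 3 * Real.log T := by
    have : A ≤ T ^ 3 := by nlinarith [hAT]
    calc Real.log A ≤ Real.log (T ^ 3) := Real.log_le_log hA0 this
      _ = 3 * Real.log T := by rw [Real.log_pow]; norm_num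
  have hApow : A ^ (2 : ℝ) = A ^ (2 * σ₀) * A ^ (2 * (1 - σ₀)) := by
    rw [← Real.rpow_add hA0]; ring_nf
  have hA2 : A ^ 2 = A ^ (2 * σ₀) * A ^ (2 * (1 - σ₀)) := by
    rw [← hApow, Real.rpow_two]
  have hAσ : 0 < A ^ (2 * σ₀) := Real.rpow_pos_of_pos hA0 _
  have h4 : κ * N ≤ Cup * A ^ (2 * (1 - σ₀)) * Real.log A ^ 2 := by
    rw [hA2] at h3
    have : κ * A ^ (2 * σ₀) * N ≤ A ^ (2 * σ₀) * (Cup * A ^ (2 * (1 - σ₀)) * Real.log A ^ 2) := by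
      linarith [h3]
    have := le_of_mul_le_mul_left (by linarith [this] : A ^ (2 * σ₀) * (κ * N) ≤
      A ^ (2 * σ₀) * (Cup * A ^ (2 * (1 - σ₀)) * Real.log A ^ 2)) hAσ
    exact this
  have h5 : A ^ (2 * (1 - σ₀)) ≤ 8 ^ 2 * T ^ (2 * (1 - σ₀)) := by
    have hexp0 : 0 ≤ 2 * (1 - σ₀) := by linarith
    calc A ^ (2 * (1 - σ₀)) ≤ (8 * T) ^ (2 * (1 - σ₀)) := Real.rpow_le_rpow hA0.le hAT hexp0
      _ = 8 ^ (2 * (1 - σ₀)) * T ^ (2 * (1 - σ₀)) := Real.mul_rpow (by norm_num) (by linarith)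
      _ ≤ 8 ^ (2 : ℝ) * T ^ (2 * (1 - σ₀)) := by
          refine mul_le_mul_of_nonneg_right ?_ (Real.rpow_nonneg (by linarith) _)
          exact Real.rpow_le_rpow_of_exponent_le (by norm_num) (by linarith)
      _ = 8 ^ 2 * T ^ (2 * (1 - σ₀)) := by rw [Real.rpow_two]
  have h6 : Real.log A ^ 2 ≤ 3 ^ 2 * Real.log T ^ 2 := by
    have hlA0 : 0 ≤ Real.log A := Real.log_nonneg (by linarith)
    nlinarith
  have hTpow : 0 ≤ T ^ (2 * (1 - σ₀)) := Real.rpow_nonneg (by linarith) _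
  calc N ≤ Cup * A ^ (2 * (1 - σ₀)) * Real.log A ^ 2 / κ := by
        rw [le_div_iff₀ hκ0]; linarith
    _ ≤ Cup * (8 ^ 2 * T ^ (2 * (1 - σ₀))) * (3 ^ 2 * Real.log T ^ 2) / κ := by
        gcongr
    _ = Cup / κ * 8 ^ 2 * 3 ^ 2 * T ^ (2 * (1 - σ₀)) * Real.log T ^ 2 := by
        field_simp

end Summit.RiemannHypothesis.RiemannHypothesis.Theorems.DensityLadderSeparatedTowerMeanValue

end
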